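import Summits.HodgeConjecture.HodgeConjecture.Theorems.R90S6LevelOneCountCayleyDictionary    -- ★ G1 RUNG 2 (A) (p864111) `forall_v_conj_sub_lt_one_iff` (the GL-level core); brings `unitaryInt`, the U(Φ₃) letters
import HarnessLib

/-!
# R90 · S6 — LINE G1 «geometric fixed subtree», (R1.0): THE LEVEL-ONE PREDICATE DOES NOT DEPEND ON THE SECTION — `(gκ)⁻¹γ(gκ) ≡ c·1 ⟺ g⁻¹γg ≡ c·1 (mod 𝔪)`
# for `κ ∈ U(𝒪)` (`Theorems/R90S6LevelOnePredicateSectionInvariance.lean`)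

Cell `hodgecm-mathlib`, crux H413 (`stmt-HodgeConjecture-24833`), route of record `HCCMUnconditional`; programme R90-TF, section S6 (base `R90-C14`), seat R90-C14-p07 (g2);
target (R1.0) `forall_v_conj_sub_smul_lt_one_iff` of the G1 sheet (`R90/R90-C14-typ1/g2/S6_G1_fixedsubtree_targets.v1.4.96937d52191e3a9e.lean` :103 = v1.5 (g3), «rides with
p07's rung 1»), statement VERBATIM; typ1 (g2)'s sorry-free scratch certificate `R90/R90-C14-typ1/g2/scratch_G1_R10.lean` bebf45ec6bc15ca0 proves the same by hand — here it
is ★ (A)'s GL-level core by name.  Helper lane `--supports stmt-HodgeConjecture-24833 --as helper`; ONE theorem (no definition, no instance, no notation, no named fact, no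
`sorry`); imports = ★ (A) `R90S6LevelOneCountCayleyDictionary` + HarnessLib.

THE MATHEMATICS [Kottwitz1988, §2; Kottwitz1986BaseChangeUnits, §1 pp. 240–241].  `U = U(σ, J₀)(K)`, `K₀ = U(𝒪) = unitaryInt σ J₀` (entries of `κ` and `κ⁻¹` integral).
The LEVEL-ONE predicate of a fixed hyperspecial vertex `x = gL₀` of `γ` reads `g⁻¹γg ≡ c·1 (mod 𝔪)` on a representative `g` of the coset `gK₀`; another representative is
`gκ`, `κ ∈ K₀`, and `(gκ)⁻¹γ(gκ) = κ⁻¹(g⁻¹γg)κ` with `κ⁻¹(M − c·1)κ = κ⁻¹Mκ − c·1`, so the predicate is representative-free (★ (A) `forall_v_conj_sub_lt_one_iff`: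
conjugation by an integral `κ` with integral inverse preserves «all entries of `M − c·1` in `𝔪`») — i.e. the count `ℓ₁(γ)` of ★ RUNG 1 does not depend on the section `r`
of `U → U ⧸ K₀` (intrinsically: `(γ − c)·x ⊆ ϖ·x`).
HONEST LABEL: valuation algebra over ★ (A); count-neutral; closes the sheet row (R1.0) only.  HC_CM is proved only modulo the 7 printed citations (2 remaining named inputs:
hLiu418 = stmt-HodgeConjecture-24832, h413 = stmt-HodgeConjecture-24833) until rung 0 closes.

## References
* [Kottwitz1988] R. E. Kottwitz, *Tamagawa numbers*, Ann. of Math. 127 (1988), §2 (fixed-point counts on buildings).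
* [Kottwitz1986BaseChangeUnits] R. E. Kottwitz, *Base change for unit elements of Hecke algebras*, Compositio Math. 60 (1986) 237–250, §1 pp. 240–241.
-/
set_option autoImplicit false
-- the mandated namespace repeats the single-problem summit's segment (`HodgeConjecture.HodgeConjecture`)
set_option linter.dupNamespace false

noncomputable section

open Literature.NumberTheory.Automorphic Literature.NumberTheory.Automorphic.HermitianLattice Literature.NumberTheory.Automorphic.UnitaryGroup
open scoped Matrix MatrixGroups WithZero

namespace Summit.HodgeConjecture.HodgeConjecture.R90.S6

/-- **G1 (R1.0) — THE LEVEL-ONE PREDICATE `k ≡ c·1 (mod 𝔪)` IS INVARIANT UNDER `K₀`-CONJUGATION**: for `γ, g ∈ U(σ, J₀)(K)`, `κ ∈ U(𝒪) = unitaryInt σ J₀` and any `c`,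
`(gκ)⁻¹γ(gκ) ≡ c·1 (mod 𝔪) ⟺ g⁻¹γg ≡ c·1 (mod 𝔪)` entrywise — so the level-one count `ℓ₁(γ)` of ★ RUNG 1 does not depend on the section `r` of `U → U ⧸ K₀`.  ★ (A)
`forall_v_conj_sub_lt_one_iff` at `M := g⁻¹γg`, `κ`'s two integrality halves from `mem_unitaryInt_iff`. [cite: Kottwitz1988, §2] [cite: Kottwitz1986BaseChangeUnits, §1 pp. 240–241] -/
theorem forall_v_conj_sub_smul_lt_one_iff {K : Type*} [Field K] [Valued K ℤᵐ⁰]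
    {σ : K →+* K} (γ g κ : ↥(unitaryGroupOfForm σ ((StdForm.antidiagonal 3).over K))) (hκ : κ ∈ unitaryInt σ ((StdForm.antidiagonal 3).over K)) (c : K) :
    (∀ i j, Valued.v (((((g * κ)⁻¹ * γ * (g * κ) : GL (Fin 3) K) : Matrix (Fin 3) (Fin 3) K)) i j - c * (1 : Matrix (Fin 3) (Fin 3) K) i j) < 1) ↔
      ∀ i j, Valued.v ((((g⁻¹ * γ * g : GL (Fin 3) K) : Matrix (Fin 3) (Fin 3) K)) i j - c * (1 : Matrix (Fin 3) (Fin 3) K) i j) < 1 := by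
  obtain ⟨hP, hQ⟩ := mem_unitaryInt_iff.mp hκ
  -- `(gκ)⁻¹γ(gκ) = κ⁻¹(g⁻¹γg)κ` on matrices
  have hmat : ((((g * κ)⁻¹ * γ * (g * κ) : GL (Fin 3) K)) : Matrix (Fin 3) (Fin 3) K) =
      ((((κ : ↥(unitaryGroupOfForm σ ((StdForm.antidiagonal 3).over K))) : GL (Fin 3) K)⁻¹ : GL (Fin 3) K) : Matrix (Fin 3) (Fin 3) K) *
        (((g⁻¹ * γ * g : GL (Fin 3) K)) : Matrix (Fin 3) (Fin 3) K) *
        (((κ : ↥(unitaryGroupOfForm σ ((StdForm.antidiagonal 3).over K))) : GL (Fin 3) K) : Matrix (Fin 3) (Fin 3) K) := by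
    simp only [Subgroup.coe_mul, Subgroup.coe_inv, mul_inv_rev, Units.val_mul, mul_assoc]
  rw [hmat]
  exact forall_v_conj_sub_lt_one_iff hP hQ c

end Summit.HodgeConjecture.HodgeConjecture.R90.S6

end
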